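import Literature.AlgebraicGeometry.Resolution.ArithmeticalThreefoldsLocalKummerCovering
import Literature.AlgebraicGeometry.Resolution.ArithmeticalThreefoldsLocalReductionOfParts
import Mathlib.FieldTheory.KummerExtension
import Mathlib.FieldTheory.Galois.GaloisClosure
import Mathlib.FieldTheory.SeparableClosure
import HarnessLib

/-!
# Tame ascent from tame descent: input (C3) of Cossart–Piltant's reduction discharged

Topic: `Literature/AlgebraicGeometry/Resolution`. PROOF side of `CossartPiltant2019ReductionP`
(`ArithmeticalThreefoldsLocal.lean`). In the chain `(LU v₀) ⇒ (LU v₀ⁱ) ⇒ (LU v₀ʳ) ⇒ (LU vʳ) ⇒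
(LU v)` of the proof of Cossart–Piltant 2019, Prop. 4.10, the step `(LU v₀ⁱ) ⇒ (LU v₀ʳ)` climbs
the tower of Galois extensions of prime degrees `ℓ ≠ p` between the inertia and the
ramification field ("Perron algorithm as in [CoP1] proposition 6.3, characteristic free"). This
file proves that step — the input (C3) of `cossartPiltant2019ReductionP_of_principalization_of_parts`
— from the input (C4) (descent below the ramification field, [CoP1] Prop. 9.3), cofinality of
local uniformizations (⇐ principalization) and embedded resolution of surfaces, by a Kummer
argument replacing the source's Perron transforms (see `ArithmeticalThreefoldsLocalKummerCovering.lean`):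
adjoin `μ_ℓ` (unramified, as `v(ℓ) = 0`), write the step as `A′(θ)` with `θ^ℓ ∈ A′` (Kummer
theory for the cyclic extension `B(ζ) | A(ζ)` of degree `ℓ`), monomialize `θ^ℓ` and pass to the
covering by `ℓ`-th roots of the parameters and the unit — regular and containing `θ` — whose
Galois group over `B(ζ)` has exponent `ℓ`, hence trivial ramification group, and descend twice.

* `valuation_pow_sub_self_eq_one` — PROVED: `v(ηζ − ζ) = 1` for a non-trivial `ℓ`-th root of
  unity `η` when `v(ℓ) = 1` (through a private copy of the tree's
  `valuation_sub_one_eq_one_of_pow_eq_one`, `TameRootLayers.lean`);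
* `isGalois_iSup_adjoin_rootSet_X_pow_sub_C`, `pow_eq_one_of_mem_aut_radical`,
  `ramificationGroupIn_eq_bot_of_pow_eq_one`, `inertiaGroupIn_eq_bot_adjoin_rootsOfUnity` —
  PROVED: Kummer coverings are finite Galois of exponent `ℓ` with trivial ramification group;
  `M(μ_ℓ) | M` has trivial inertia group;
* `exists_kummer_generator` — PROVED: for a Galois step `A ≤ B` of prime degree `ℓ`,
  `[B(ζ) : A(ζ)] = ℓ` and `B(ζ) = A(ζ)(θ)` with `θ^ℓ ∈ A(ζ)` (Mathlib's Kummer theory over the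
  rebased extension, `TameTowerRebase.lean`);
* `tameAscent_of_descent` — PROVED: (C3) from (C4), cofinality and embedded resolution;
* `cossartPiltant2019ReductionP_of_principalization_of_descent` — PROVED:
  `CossartPiltant2019Local → CossartPiltant2019Principalization → (embedded resolution of
  surfaces) → (C4) → (C5) → CossartPiltant2019ReductionP`.

Everything is PROVED; no named facts are introduced (embedded resolution, (C4) and (C5) are
hypotheses).

## Sources

* V. Cossart, O. Piltant, J. Algebra 529 (2019) 268–535 = arXiv:1412.0868, Props. 4.3, 4.4 and
  proof of Prop. 4.10 (arXiv v1: Props. 4.2, 4.3, 4.8, pp. 50–54). [CossartPiltant2019]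
* V. Cossart, O. Piltant, J. Algebra 320 (2008) 1051–1082, Prop. 6.3, Lemma 9.4, Prop. 9.3 (HAL
  hal-00139124: Prop. 8.3 pp. 23–26, Lemma 9.4 pp. 28–29, Prop. 9.5 p. 30). [CossartPiltant2008]
* V. Cossart, U. Jannsen, S. Saito, LNM 2270 (2020), Cor. 1.5, p. 7. [CossartJannsenSaito2020]
* O. Zariski, P. Samuel, *Commutative Algebra* II, Ch. VI §12, Thm. 24, p. 77. [ZariskiSamuel1960]
-/

noncomputable section

open CategoryTheory AlgebraicGeometry TopologicalSpace IsLocalRing _root_.Polynomial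
  _root_.IntermediateField

namespace Literature.AlgebraicGeometry.Resolution

universe u

/-! ## Roots of unity under a valuation with `v(ℓ) = 1` -/

section RootsOfUnity

variable {E : Type u} [Field E] (O : ValuationSubring E)

/-- **Non-trivial `ℓ`-th roots of unity are far from `1` when `ℓ` is a `v`-unit**: if `η^ℓ = 1`,
`η ≠ 1` and `v(ℓ) = 1` then `v(η − 1) = 1` (were `η ≡ 1 (mod 𝔪_v)`, the geometric sum
`1 + η + ⋯ + η^{ℓ−1}`, which vanishes, would be `≡ ℓ ≢ 0`). [folklore] -/
private theorem valuation_rootOfUnity_sub_one_eq_one {ℓ : ℕ} (hℓ : O.valuation (ℓ : E) = 1) {η : E}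
    (hη : η ^ ℓ = 1) (hη1 : η ≠ 1) : O.valuation (η - 1) = 1 := by
  have hℓ0 : ℓ ≠ 0 := by
    rintro rfl
    rw [Nat.cast_zero, map_zero] at hℓ
    exact zero_ne_one hℓ
  -- `v(η) = 1`
  have hvη : O.valuation η = 1 := by
    have h1 : O.valuation η ^ ℓ = 1 := by rw [← map_pow, hη, map_one]
    rcases pow_eq_one_iff.mp h1 with h | h
    · exact h
    · exact absurd h hℓ0
  have hle : O.valuation (η - 1) ≤ 1 := by
    refine (Valuation.map_sub _ _ _).trans ?_
    rw [hvη, map_one, max_self]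
  by_contra hne
  have hlt : O.valuation (η - 1) < 1 := lt_of_le_of_ne hle hne
  -- the geometric sum vanishes …
  have hgeom : (∑ i ∈ Finset.range ℓ, η ^ i) = 0 := by
    have h1 : (∑ i ∈ Finset.range ℓ, η ^ i) * (η - 1) = 0 := by rw [geom_sum_mul, hη, sub_self]
    exact (mul_eq_zero.mp h1).resolve_right (sub_ne_zero.mpr hη1)
  -- … but is `≡ ℓ`
  have hterm : ∀ i, O.valuation (η ^ i - 1) < 1 := by
    intro i
    have h1 : η ^ i - 1 = (∑ j ∈ Finset.range i, η ^ j) * (η - 1) := (geom_sum_mul η i).symm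
    rw [h1, map_mul]
    have h2 : O.valuation (∑ j ∈ Finset.range i, η ^ j) ≤ 1 := by
      refine Valuation.map_sum_le _ fun j _ => ?_
      rw [map_pow, hvη, one_pow]
    calc O.valuation (∑ j ∈ Finset.range i, η ^ j) * O.valuation (η - 1)
        ≤ 1 * O.valuation (η - 1) := by gcongr
      _ < 1 := by rw [one_mul]; exact hlt
  have hsum : O.valuation (∑ i ∈ Finset.range ℓ, (η ^ i - 1)) < 1 :=
    Valuation.map_sum_lt _ one_ne_zero fun i _ => hterm i
  have hsplit : (∑ i ∈ Finset.range ℓ, η ^ i) = (∑ i ∈ Finset.range ℓ, (η ^ i - 1)) + ℓ := by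
    rw [Finset.sum_sub_distrib, Finset.sum_const, Finset.card_range, nsmul_eq_mul, mul_one,
      sub_add_cancel]
  have h1 : O.valuation (∑ i ∈ Finset.range ℓ, η ^ i) = 1 := by
    rw [hsplit, Valuation.map_add_eq_of_lt_right _ (by rw [hℓ]; exact hsum), hℓ]
  rw [hgeom, map_zero] at h1
  exact zero_ne_one h1

/-- For a primitive `ℓ`-th root of unity `ζ` and `v(ℓ) = 1`: `v(ζ^k − ζ) = 1` unless `ζ^k = ζ`.
[folklore] -/
theorem valuation_pow_sub_self_eq_one {ℓ : ℕ} (hℓ : O.valuation (ℓ : E) = 1) {ζ : E}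
    (hζ : ζ ^ ℓ = 1) {η : E} (hη : η ^ ℓ = 1) (hne : η * ζ ≠ ζ) :
    O.valuation (η * ζ - ζ) = 1 := by
  have hvζ : O.valuation ζ = 1 := by
    have hℓ0 : ℓ ≠ 0 := by
      rintro rfl
      rw [Nat.cast_zero, map_zero] at hℓ
      exact zero_ne_one hℓ
    have h1 : O.valuation ζ ^ ℓ = 1 := by rw [← map_pow, hζ, map_one]
    rcases pow_eq_one_iff.mp h1 with h | h
    · exact h
    · exact absurd h hℓ0
  have hη1 : η ≠ 1 := fun h => hne (by rw [h, one_mul])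
  rw [show η * ζ - ζ = (η - 1) * ζ by ring, map_mul, hvζ, mul_one]
  exact valuation_rootOfUnity_sub_one_eq_one O hℓ hη hη1

end RootsOfUnity

/-! ## Radical extensions: finite, Galois, of exponent `ℓ` -/

section Radical

variable {E : Type u} [Field E] {M : Subfield E}

/-- The intermediate field generated by the roots of a separable polynomial that splits is a
finite Galois extension. [folklore] -/
theorem isGalois_and_finiteDimensional_adjoin_rootSet {q : Polynomial M} (hsep : q.Separable)
    (hsplit : (q.map (algebraMap M E)).Splits) :
    IsGalois M (adjoin M (q.rootSet E)) ∧ FiniteDimensional M (adjoin M (q.rootSet E)) := by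
  haveI := IntermediateField.adjoin_rootSet_isSplittingField hsplit
  exact ⟨IsGalois.of_separable_splitting_field hsep,
    Polynomial.IsSplittingField.finiteDimensional _ q⟩

/-- `X^ℓ − c` over `M` (`c ≠ 0`, `ℓ ≠ 0` in `E`) is separable and splits in an algebraically
closed `E`. [folklore] -/
theorem separable_and_splits_X_pow_sub_C [IsAlgClosed E] {ℓ : ℕ} (hℓ : (ℓ : E) ≠ 0) {c : M}
    (hc : c ≠ 0) :
    (X ^ ℓ - C c : Polynomial M).Separable ∧ ((X ^ ℓ - C c : Polynomial M).map (algebraMap M E)).Splits := by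
  refine ⟨separable_X_pow_sub_C c (fun h => hℓ ?_) hc, IsAlgClosed.splits _⟩
  have : ((ℓ : M) : E) = (ℓ : E) := map_natCast (algebraMap M E) ℓ
  rw [← this, h]; rfl

/-- **The radical extension `N = M(c_j^{1/ℓ} : j)`** generated by ALL the `ℓ`-th roots of finitely
many non-zero `c_j ∈ M` (`ℓ ≠ 0` in `E`, `E` algebraically closed): a finite Galois extension
of `M`. [folklore] -/
theorem isGalois_iSup_adjoin_rootSet_X_pow_sub_C [IsAlgClosed E] {ℓ : ℕ} (hℓ : (ℓ : E) ≠ 0)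
    {ι : Type} [Finite ι] (c : ι → M) (hc : ∀ j, c j ≠ 0) :
    IsGalois M (⨆ j, adjoin M ((X ^ ℓ - C (c j) : Polynomial M).rootSet E) : IntermediateField M E) ∧
      FiniteDimensional M
        (⨆ j, adjoin M ((X ^ ℓ - C (c j) : Polynomial M).rootSet E) : IntermediateField M E) := by
  have hG : ∀ j, IsGalois M (adjoin M ((X ^ ℓ - C (c j) : Polynomial M).rootSet E)) ∧
      FiniteDimensional M (adjoin M ((X ^ ℓ - C (c j) : Polynomial M).rootSet E)) := fun j =>
    isGalois_and_finiteDimensional_adjoin_rootSet (separable_and_splits_X_pow_sub_C hℓ (hc j)).1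
      (separable_and_splits_X_pow_sub_C hℓ (hc j)).2
  haveI : ∀ j, IsGalois M (adjoin M ((X ^ ℓ - C (c j) : Polynomial M).rootSet E)) := fun j => (hG j).1
  haveI : ∀ j, FiniteDimensional M (adjoin M ((X ^ ℓ - C (c j) : Polynomial M).rootSet E)) :=
    fun j => (hG j).2
  haveI : ∀ j, Normal M (adjoin M ((X ^ ℓ - C (c j) : Polynomial M).rootSet E)) := fun j =>
    inferInstance
  refine ⟨?_, inferInstance⟩
  exact IsGalois.mk

/-- The roots of `X^ℓ − c`, `c = r^ℓ`, are the `ζ^i r` for a primitive `ℓ`-th root of unity `ζ`.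
[folklore] -/
theorem mem_rootSet_X_pow_sub_C_iff {ℓ : ℕ} (hℓ0 : ℓ ≠ 0) {ζ : E} (hζ : IsPrimitiveRoot ζ ℓ)
    {c : M} {r : E} (hr : r ^ ℓ = (c : E)) (hr0 : r ≠ 0) (x : E) :
    x ∈ ((X ^ ℓ - C c : Polynomial M).rootSet E) ↔ ∃ i < ℓ, x = ζ ^ i * r := by
  haveI : NeZero ℓ := ⟨hℓ0⟩
  have hne : (X ^ ℓ - C c : Polynomial M) ≠ 0 := X_pow_sub_C_ne_zero (Nat.pos_of_ne_zero hℓ0) c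
  rw [Polynomial.mem_rootSet_of_ne hne]
  simp only [map_sub, map_pow, aeval_X, aeval_C]
  change x ^ ℓ - (c : E) = 0 ↔ _
  rw [sub_eq_zero, ← hr]
  constructor
  · intro h
    have h1 : (x / r) ^ ℓ = 1 := by rw [div_pow, h, div_self (pow_ne_zero _ hr0)]
    obtain ⟨i, hi, hix⟩ := hζ.eq_pow_of_pow_eq_one h1
    exact ⟨i, hi, by rw [hix, div_mul_cancel₀ _ hr0]⟩
  · rintro ⟨i, -, rfl⟩
    rw [mul_pow, ← pow_mul, mul_comm i ℓ, pow_mul, hζ.pow_eq_one, one_pow, one_mul]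

/-- **Kummer coverings have exponent `ℓ`**: if `ζ ∈ M` is a primitive `ℓ`-th root of unity and
`N = M(r_j : j)` with `r_j^ℓ = c_j ∈ M`, `c_j ≠ 0`, then every `M`-automorphism `σ` of `N` has
`σ^ℓ = 1` (`σ r_j = ζ^{i_j} r_j`). [folklore] -/
theorem pow_eq_one_of_mem_aut_radical {ℓ : ℕ} (hℓ0 : ℓ ≠ 0) {ζ : E} (hζ : IsPrimitiveRoot ζ ℓ)
    (hζM : ζ ∈ M) {ι : Type} (c : ι → M) (hc : ∀ j, c j ≠ 0) (r : ι → E)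
    (hr : ∀ j, r j ^ ℓ = (c j : E))
    (N : IntermediateField M E)
    (hN : N = adjoin M (⋃ j, ((X ^ ℓ - C (c j) : Polynomial M).rootSet E)))
    (σ : N ≃ₐ[M] N) : σ ^ ℓ = 1 := by
  classical
  subst hN
  have hr0 : ∀ j, r j ≠ 0 := fun j h0 => hc j (by
    have h1 := hr j
    rw [h0, zero_pow hℓ0] at h1
    exact_mod_cast h1.symm)
  -- every generator is moved by a root of unity, which `σ` fixes
  have key : ∀ (x : E) (hx : x ∈ ⋃ j, ((X ^ ℓ - C (c j) : Polynomial M).rootSet E)),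
      ((σ ^ ℓ) ⟨x, subset_adjoin _ _ hx⟩ : E) = x := by
    intro x hx
    obtain ⟨j, hxj⟩ := Set.mem_iUnion.mp hx
    obtain ⟨i, -, rfl⟩ := (mem_rootSet_X_pow_sub_C_iff hℓ0 hζ (hr j) (hr0 j) _).mp hxj
    set y : adjoin M (⋃ j, ((X ^ ℓ - C (c j) : Polynomial M).rootSet E)) :=
      ⟨ζ ^ i * r j, subset_adjoin _ _ hx⟩ with hy
    -- `σ y = η • y` with `η^ℓ = 1`, `η ∈ M`
    have hyℓ : (y : E) ^ ℓ = (c j : E) := by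
      change (ζ ^ i * r j) ^ ℓ = _
      rw [mul_pow, ← pow_mul, mul_comm i ℓ, pow_mul, hζ.pow_eq_one, one_pow, one_mul, hr j]
    have hσy : ((σ y : _) : E) ^ ℓ = (c j : E) := by
      have h1 : σ (y ^ ℓ) = σ y ^ ℓ := map_pow σ y ℓ
      have h2 : y ^ ℓ = algebraMap M _ (c j) := Subtype.ext (by
        rw [SubmonoidClass.coe_pow, hyℓ]; rfl)
      rw [h2, AlgEquiv.commutes] at h1
      have h3 := congrArg (fun z : adjoin M (⋃ j, ((X ^ ℓ - C (c j) : Polynomial M).rootSet E)) =>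
        (z : E)) h1
      simp only [SubmonoidClass.coe_pow] at h3
      rw [← h3]
      rfl
    have hy0 : (y : E) ≠ 0 := mul_ne_zero (pow_ne_zero _ (hζ.ne_zero hℓ0)) (hr0 j)
    haveI : NeZero ℓ := ⟨hℓ0⟩
    have hcj0 : ((c j : M) : E) ≠ 0 := by rw [← hr j]; exact pow_ne_zero _ (hr0 j)
    obtain ⟨k, -, hk⟩ : ∃ k < ℓ, ((σ y : _) : E) = ζ ^ k * (y : E) := by
      have h1 : (((σ y : _) : E) / (y : E)) ^ ℓ = 1 := by
        rw [div_pow, hσy, hyℓ, div_self hcj0]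
      obtain ⟨k, hk, hkx⟩ := hζ.eq_pow_of_pow_eq_one h1
      exact ⟨k, hk, by rw [hkx, div_mul_cancel₀ _ hy0]⟩
    -- the scalar `ζ^k ∈ M`
    let η : M := ⟨ζ ^ k, M.pow_mem hζM k⟩
    have hσy' : σ y = η • y := Subtype.ext (by
      rw [hk]
      rfl)
    have hiter : ∀ m : ℕ, (σ ^ m) y = (η ^ m) • y := by
      intro m
      induction m with
      | zero => simp
      | succ m ih =>
        rw [pow_succ', AlgEquiv.mul_apply, ih, map_smul, hσy', smul_smul, ← pow_succ]
    have hηℓ : η ^ ℓ = 1 := Subtype.ext (by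
      change (ζ ^ k) ^ ℓ = 1
      rw [← pow_mul, mul_comm, pow_mul, hζ.pow_eq_one, one_pow])
    have := hiter ℓ
    rw [hηℓ, one_smul] at this
    exact congrArg Subtype.val this
  apply AlgEquiv.coe_toAlgHom_injective
  refine IntermediateField.adjoin_algHom_ext M fun x hx => Subtype.ext ?_
  rw [AlgEquiv.coe_toAlgHom, AlgEquiv.coe_toAlgHom, AlgEquiv.one_apply]
  exact key x hx

end Radical

/-! ## Ramification and inertia of radical and cyclotomic extensions -/

section Groups

variable {E : Type u} [Field E] (O : ValuationSubring E) {M : Subfield E}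

/-- **A Galois extension of exponent prime to `p` has trivial (large) ramification group**: the
ramification group is a `p`-group (Zariski–Samuel VI §12 Thm. 24), so if every automorphism
`σ` satisfies `σ^ℓ = 1` with `p ∤ ℓ` it is trivial. [cite: ZariskiSamuel1960, Ch. VI §12, Thm. 24, p. 77] -/
theorem ramificationGroupIn_eq_bot_of_pow_eq_one {p : ℕ} [Fact p.Prime] [CharP (ResidueField O) p]
    (N : IntermediateField M E) [FiniteDimensional M N] {ℓ : ℕ} (hpl : ¬ p ∣ ℓ)
    (hexp : ∀ σ : N ≃ₐ[M] N, σ ^ ℓ = 1) : ramificationGroupIn O N = ⊥ := by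
  rw [eq_bot_iff]
  intro g hg
  obtain ⟨k, hk⟩ := isPGroup_ramificationGroupIn O N ⟨g, hg⟩
  have hk' : g ^ p ^ k = 1 := by
    have := congrArg Subtype.val hk
    simpa using this
  have hcop : Nat.Coprime (p ^ k) ℓ :=
    Nat.Coprime.pow_left k ((Nat.Prime.coprime_iff_not_dvd Fact.out).mpr hpl)
  have h1 : g ^ Nat.gcd (p ^ k) ℓ = 1 := pow_gcd_eq_one.mpr ⟨hk', hexp g⟩
  rw [hcop.gcd_eq_one, pow_one] at h1
  exact h1

/-- **Adjoining the `ℓ`-th roots of unity is unramified when `v(ℓ) = 1`**: the inertia group of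
`N = M(μ_ℓ)` is trivial (an element of inertia moves `ζ` to `ζ^k` with `v(ζ^k − ζ) < 1`, forcing
`ζ^k = ζ` by `valuation_pow_sub_self_eq_one`), hence so is the ramification group, and both the
inertia and the ramification field are all of `N`. [folklore] -/
theorem inertiaGroupIn_eq_bot_adjoin_rootsOfUnity {ℓ : ℕ} (hℓ0 : ℓ ≠ 0)
    (hℓ : O.valuation (ℓ : E) = 1) {ζ : E} (hζ : IsPrimitiveRoot ζ ℓ)
    (N : IntermediateField M E)
    (hN : N = adjoin M ((X ^ ℓ - C (1 : M) : Polynomial M).rootSet E)) :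
    inertiaGroupIn O N = ⊥ := by
  classical
  subst hN
  haveI : NeZero ℓ := ⟨hℓ0⟩
  have hroots : ∀ x : E, x ∈ ((X ^ ℓ - C (1 : M) : Polynomial M).rootSet E) ↔ ∃ i < ℓ, x = ζ ^ i * 1 :=
    mem_rootSet_X_pow_sub_C_iff hℓ0 hζ (c := (1 : M)) (r := 1) (by simp) one_ne_zero
  have hζmem : ζ ∈ ((X ^ ℓ - C (1 : M) : Polynomial M).rootSet E) :=
    by
      by_cases h1 : 1 < ℓ
      · exact (hroots ζ).mpr ⟨1, h1, by rw [pow_one, mul_one]⟩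
      · have hℓ1 : ℓ = 1 := by omega
        refine (hroots ζ).mpr ⟨0, Nat.pos_of_ne_zero hℓ0, ?_⟩
        have : ζ = 1 := by
          have := hζ.pow_eq_one
          rwa [hℓ1, pow_one] at this
        rw [pow_zero, mul_one, this]
  have hvζ : O.valuation ζ = 1 := by
    have h1 : O.valuation ζ ^ ℓ = 1 := by rw [← map_pow, hζ.pow_eq_one, map_one]
    rcases pow_eq_one_iff.mp h1 with h | h
    · exact h
    · exact absurd h hℓ0
  have hζO : ζ ∈ O := (O.valuation_le_one_iff _).mp hvζ.le
  rw [eq_bot_iff]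
  intro σ hσ
  rw [mem_inertiaGroupIn_iff] at hσ
  let z : adjoin M ((X ^ ℓ - C (1 : M) : Polynomial M).rootSet E) := ⟨ζ, subset_adjoin _ _ hζmem⟩
  -- `σ ζ = η ζ` with `η^ℓ = 1`, and `v(σ ζ − ζ) < 1` forces `σ ζ = ζ`
  have hσz : ((σ z : _) : E) ^ ℓ = 1 := by
    have h1 : σ (z ^ ℓ) = σ z ^ ℓ := map_pow σ z ℓ
    have h2 : z ^ ℓ = 1 := Subtype.ext (by
      rw [SubmonoidClass.coe_pow, OneMemClass.coe_one]; exact hζ.pow_eq_one)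
    rw [h2, show σ 1 = 1 from map_one σ] at h1
    have h3 := congrArg (fun w : adjoin M ((X ^ ℓ - C (1 : M) : Polynomial M).rootSet E) => (w : E)) h1
    simp only [OneMemClass.coe_one, SubmonoidClass.coe_pow] at h3
    exact h3.symm
  have hfix : ((σ z : _) : E) = ζ := by
    by_contra hne
    let η : E := ((σ z : _) : E) / ζ
    have hζ0 : ζ ≠ 0 := hζ.ne_zero hℓ0
    have hη : η ^ ℓ = 1 := by
      change (((σ z : _) : E) / ζ) ^ ℓ = 1
      rw [div_pow, hσz, hζ.pow_eq_one, div_one]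
    have hηζ : η * ζ = ((σ z : _) : E) := div_mul_cancel₀ _ hζ0
    have h1 := valuation_pow_sub_self_eq_one O hℓ hζ.pow_eq_one hη (by rw [hηζ]; exact hne)
    rw [hηζ] at h1
    have h2 := hσ.2 z hζO
    change O.valuation (((σ z : _) : E) - ζ) < 1 at h2
    rw [h1] at h2
    exact lt_irrefl _ h2
  -- hence `σ` fixes every root of unity, i.e. `σ = 1`
  rw [Subgroup.mem_bot]
  apply AlgEquiv.coe_toAlgHom_injective
  refine IntermediateField.adjoin_algHom_ext M fun x hx => Subtype.ext ?_
  rw [AlgEquiv.coe_toAlgHom, AlgEquiv.coe_toAlgHom, AlgEquiv.one_apply]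
  obtain ⟨i, -, hxi⟩ := (hroots x).mp hx
  have h1 : (⟨x, subset_adjoin _ _ hx⟩ :
      adjoin M ((X ^ ℓ - C (1 : M) : Polynomial M).rootSet E)) = z ^ i :=
    Subtype.ext (by
      change x = ((z ^ i : adjoin M ((X ^ ℓ - C (1 : M) : Polynomial M).rootSet E)) : E)
      rw [SubmonoidClass.coe_pow, hxi, mul_one])
  rw [h1, map_pow, SubmonoidClass.coe_pow, SubmonoidClass.coe_pow, hfix]

/-- With trivial inertia, the inertia field and the ramification field are the whole
extension. [folklore] -/
theorem lift_fixedField_eq_of_inertiaGroupIn_eq_bot (N : IntermediateField M E)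
    [FiniteDimensional M N] [IsGalois M N] (h : inertiaGroupIn O N = ⊥) :
    (lift (fixedField (inertiaGroupIn O N))).toSubfield = N.toSubfield ∧
      (lift (fixedField (ramificationGroupIn O N))).toSubfield = N.toSubfield := by
  have hr : ramificationGroupIn O N = ⊥ :=
    le_bot_iff.mp (h ▸ ramificationGroupIn_le_inertiaGroupIn O N)
  rw [h, hr, IntermediateField.fixedField_bot, IntermediateField.lift_top]
  exact ⟨rfl, rfl⟩

/-- With trivial ramification group, the ramification field is the whole extension. [folklore] -/
theorem lift_fixedField_ramificationGroupIn_eq_of_eq_bot (N : IntermediateField M E)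
    [FiniteDimensional M N] [IsGalois M N] (h : ramificationGroupIn O N = ⊥) :
    (lift (fixedField (ramificationGroupIn O N))).toSubfield = N.toSubfield := by
  rw [h, IntermediateField.fixedField_bot, IntermediateField.lift_top]

end Groups

/-! ## The cyclotomic field `M(μ_ℓ)` and the Kummer generator of a prime Galois step -/

section Kummer

variable {E : Type u} [Field E] [IsAlgClosed E]

omit [IsAlgClosed E] in
/-- `M(μ_ℓ) = M(ζ)` for a primitive `ℓ`-th root of unity `ζ`: as subfields, the field generated by
the roots of `X^ℓ − 1` over `M` is `closure (M ∪ {ζ})`. [folklore] -/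
theorem toSubfield_adjoin_rootSet_X_pow_sub_one {ℓ : ℕ} (hℓ0 : ℓ ≠ 0) {ζ : E}
    (hζ : IsPrimitiveRoot ζ ℓ) (M : Subfield E) :
    (adjoin M ((X ^ ℓ - C (1 : M) : Polynomial M).rootSet E)).toSubfield =
      Subfield.closure ((M : Set E) ∪ {ζ}) := by
  haveI : NeZero ℓ := ⟨hℓ0⟩
  have hroots : ∀ x : E, x ∈ ((X ^ ℓ - C (1 : M) : Polynomial M).rootSet E) ↔ ∃ i < ℓ, x = ζ ^ i * 1 :=
    mem_rootSet_X_pow_sub_C_iff hℓ0 hζ (c := (1 : M)) (r := 1) (by simp) one_ne_zero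
  change Subfield.closure (Set.range (algebraMap M E) ∪ _) = _
  have hrM : Set.range (algebraMap M E) = (M : Set E) := Subtype.range_coe
  rw [hrM]
  apply le_antisymm
  · rw [Subfield.closure_le]
    rintro x (hx | hx)
    · exact Subfield.subset_closure (Or.inl hx)
    · obtain ⟨i, -, rfl⟩ := (hroots x).mp hx
      rw [mul_one]
      have hζmem : ζ ∈ Subfield.closure ((M : Set E) ∪ {ζ}) := Subfield.subset_closure (Or.inr rfl)
      exact pow_mem hζmem i
  · rw [Subfield.closure_le]
    rintro x (hx | hx)
    · exact Subfield.subset_closure (Or.inl hx)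
    · rw [Set.mem_singleton_iff.mp hx]
      refine Subfield.subset_closure (Or.inr ?_)
      by_cases h1 : 1 < ℓ
      · exact (hroots ζ).mpr ⟨1, h1, by rw [pow_one, mul_one]⟩
      · have hℓ1 : ℓ = 1 := by omega
        refine (hroots ζ).mpr ⟨0, Nat.pos_of_ne_zero hℓ0, ?_⟩
        have : ζ = 1 := by
          have := hζ.pow_eq_one
          rwa [hℓ1, pow_one] at this
        rw [pow_zero, mul_one, this]

omit [IsAlgClosed E] in
/-- `[M(ζ) : M] < ℓ` for a primitive `ℓ`-th root of unity `ζ`, `ℓ` prime (`ζ` is a root of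
`1 + X + ⋯ + X^{ℓ−1}`). [folklore] -/
theorem finrank_adjoin_rootSet_X_pow_sub_one_lt {ℓ : ℕ} (hℓ : ℓ.Prime) {ζ : E}
    (hζ : IsPrimitiveRoot ζ ℓ) (M : Subfield E) :
    Module.finrank M (adjoin M ((X ^ ℓ - C (1 : M) : Polynomial M).rootSet E)) < ℓ := by
  classical
  have hℓ0 : ℓ ≠ 0 := hℓ.ne_zero
  haveI : NeZero ℓ := ⟨hℓ0⟩
  -- `M(μ_ℓ) = M⟮ζ⟯`
  have heq : adjoin M ((X ^ ℓ - C (1 : M) : Polynomial M).rootSet E) = adjoin M ({ζ} : Set E) := by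
    apply IntermediateField.toSubfield_injective
    rw [toSubfield_adjoin_rootSet_X_pow_sub_one hℓ0 hζ M]
    change _ = Subfield.closure (Set.range (algebraMap M E) ∪ {ζ})
    rw [show Set.range (algebraMap M E) = (M : Set E) from Subtype.range_coe]
  rw [heq]
  -- `ζ` is a root of the geometric sum, of degree `ℓ − 1`
  have hζ1 : ζ ≠ 1 := hζ.ne_one hℓ.one_lt
  let g : Polynomial M := ∑ i ∈ Finset.range ℓ, X ^ i
  have hgζ : aeval ζ g = 0 := by
    have h1 : aeval ζ g = ∑ i ∈ Finset.range ℓ, ζ ^ i := by simp [g]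
    have h2 : (∑ i ∈ Finset.range ℓ, ζ ^ i) * (ζ - 1) = 0 := by
      rw [geom_sum_mul, hζ.pow_eq_one, sub_self]
    rw [h1]
    exact (mul_eq_zero.mp h2).resolve_right (sub_ne_zero.mpr hζ1)
  have hg0 : g ≠ 0 := by
    intro h0
    have h1 : (g.coeff 0 : M) = 1 := by
      simp only [g, finsetSum_coeff, coeff_X_pow]
      rw [Finset.sum_eq_single 0]
      · simp
      · intro b _ hb; simp [Ne.symm hb]
      · intro h; exact absurd (Finset.mem_range.mpr (Nat.pos_of_ne_zero hℓ0)) h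
    rw [h0, coeff_zero] at h1
    exact zero_ne_one h1
  have hint : IsIntegral M ζ := ⟨X ^ ℓ - C 1, monic_X_pow_sub_C _ hℓ0, by
    simp [hζ.pow_eq_one]⟩
  rw [IntermediateField.adjoin.finrank hint]
  have hdvd : minpoly M ζ ∣ g := minpoly.dvd M ζ hgζ
  have hdeg : (minpoly M ζ).natDegree ≤ g.natDegree := Polynomial.natDegree_le_of_dvd hdvd hg0
  have hgdeg : g.natDegree ≤ ℓ - 1 := by
    refine Polynomial.natDegree_sum_le_of_forall_le _ _ fun i hi => ?_
    rw [natDegree_X_pow]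
    have := Finset.mem_range.mp hi
    omega
  have := hℓ.one_lt
  omega

/-- **The Kummer generator of a Galois step of prime degree `ℓ` after adjoining `μ_ℓ`.** Let
`A ≤ B` be subfields of an algebraically closed `E` with `B | A` Galois of prime degree `ℓ`,
`ℓ ≠ 0` in `E`, `ζ` a primitive `ℓ`-th root of unity, `A′ = A(ζ)`, `B′ = B(ζ)`. Then
`[B′ : A′] = ℓ` (`ℓ ∣ [B′ : A] = [B′ : A′][A′ : A]` with `[A′ : A] < ℓ`, and `[B′ : A′] ≤ ℓ`), `B′ | A′`
is cyclic, and by Kummer theory `B′ = A′(θ)` with `θ^ℓ ∈ A′`: there is `θ ≠ 0` with `θ^ℓ ∈ A′`,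
`B ⊆ closure (A′ ∪ {θ})` and `θ ∈ closure (B ∪ {ζ})`.
[cite: CossartPiltant2008, proof of Lemma 9.4 (HAL p. 29) "it can be assumed that `μ_l ⊂ K`"] -/
theorem exists_kummer_generator (A B : Subfield E) (hAB : A ≤ B) {ℓ : ℕ} (hℓ : ℓ.Prime)
    (hℓE : (ℓ : E) ≠ 0) (hfin : Module.finrank A (Subfield.extendScalars hAB) = ℓ)
    (hgal : IsGalois A (Subfield.extendScalars hAB)) {ζ : E} (hζ : IsPrimitiveRoot ζ ℓ) :
    ∃ θ : E, θ ≠ 0 ∧ θ ^ ℓ ∈ Subfield.closure ((A : Set E) ∪ {ζ}) ∧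
      B ≤ Subfield.closure ((Subfield.closure ((A : Set E) ∪ {ζ}) : Set E) ∪ {θ}) ∧
      θ ∈ Subfield.closure ((B : Set E) ∪ {ζ}) := by
  classical
  have hℓ0 : ℓ ≠ 0 := hℓ.ne_zero
  haveI : NeZero ℓ := ⟨hℓ0⟩
  haveI : Fact ℓ.Prime := ⟨hℓ⟩
  -- the players, as intermediate fields over `A`
  let Aζ : IntermediateField A E := adjoin A ((X ^ ℓ - C (1 : A) : Polynomial A).rootSet E)
  let BA : IntermediateField A E := Subfield.extendScalars hAB
  haveI : IsGalois A BA := hgal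
  haveI : FiniteDimensional A BA := Module.finite_of_finrank_pos (by rw [hfin]; exact hℓ.pos)
  obtain ⟨hsep1, hspl1⟩ := separable_and_splits_X_pow_sub_C (M := A) hℓE (one_ne_zero)
  obtain ⟨hGalAζ, hfinAζ⟩ := isGalois_and_finiteDimensional_adjoin_rootSet (M := A) hsep1 hspl1
  haveI := hGalAζ
  haveI := hfinAζ
  let Bζ : IntermediateField A E := Aζ ⊔ BA
  haveI : IsGalois A Bζ := inferInstance
  haveI : FiniteDimensional A Bζ := inferInstance
  have hAζsub : Aζ.toSubfield = Subfield.closure ((A : Set E) ∪ {ζ}) :=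
    toSubfield_adjoin_rootSet_X_pow_sub_one hℓ0 hζ A
  have hBAsub : BA.toSubfield = B := rfl
  -- `Aζ` as an intermediate field `S` of `Bζ | A`, and the rebased extension `L | K`
  have hAAζ : A ≤ Aζ.toSubfield := fun x hx => Aζ.algebraMap_mem ⟨x, hx⟩
  have hAζBζ : Aζ.toSubfield ≤ Bζ.toSubfield := fun x hx =>
    (le_sup_left : Aζ ≤ Bζ) hx
  obtain ⟨S, hS, -⟩ := exists_intermediateField_lift_toSubfield_eq Bζ Aζ.toSubfield hAAζ hAζBζ
  haveI := finiteDimensional_extendScalars_lift S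
  haveI := isGalois_extendScalars_lift S
  -- degrees: `[Bζ : S] = ℓ`
  have hliftS : lift S = Aζ := IntermediateField.toSubfield_injective hS
  have hfinS : Module.finrank A S = Module.finrank A Aζ := by
    rw [← hliftS]
    exact (IntermediateField.equivMap S Bζ.val).toLinearEquiv.finrank_eq
  haveI : Module.Free A S := Module.Free.of_divisionRing A S
  haveI : Module.Free S Bζ := Module.Free.of_divisionRing S Bζ
  have htower : Module.finrank A S * Module.finrank S Bζ = Module.finrank A Bζ :=
    Module.finrank_mul_finrank A S Bζ
  have hsup : Module.finrank A Bζ ≤ Module.finrank A Aζ * ℓ := by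
    rw [← hfin]
    exact IntermediateField.finrank_sup_le Aζ BA
  have hdvd : ℓ ∣ Module.finrank A Bζ := by
    -- `[Bζ : A] = [B : A] · [Bζ : B]` at the level of subfields of `E`
    have hBBζ : B ≤ Bζ.toSubfield := fun x hx => (le_sup_right : BA ≤ Bζ) (show x ∈ BA from hx)
    have h1 := Subfield.relfinrank_mul_relfinrank hAB hBBζ
    rw [Subfield.relfinrank_eq_finrank_of_le hAB, hfin,
      Subfield.relfinrank_eq_finrank_of_le (hAB.trans hBBζ)] at h1
    have h2 : Subfield.extendScalars (hAB.trans hBBζ) = Bζ :=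
      IntermediateField.toSubfield_injective rfl
    rw [h2] at h1
    exact Dvd.intro _ h1
  have ha : Module.finrank A Aζ < ℓ := finrank_adjoin_rootSet_X_pow_sub_one_lt hℓ hζ A
  have ha0 : 0 < Module.finrank A Aζ := Module.finrank_pos
  have hr : Module.finrank S Bζ = ℓ := by
    rw [hfinS] at htower
    have hn0 : 0 < Module.finrank A Bζ := Module.finrank_pos
    have h1 : ℓ ∣ Module.finrank A Aζ * Module.finrank S Bζ := by rw [htower]; exact hdvd
    have h2 : ¬ ℓ ∣ Module.finrank A Aζ := fun h => by
      have := Nat.le_of_dvd ha0 h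
      omega
    have h3 : ℓ ∣ Module.finrank S Bζ := (hℓ.dvd_mul.mp h1).resolve_left h2
    have h4 : Module.finrank S Bζ ≤ ℓ := by
      have : Module.finrank A Aζ * Module.finrank S Bζ ≤ Module.finrank A Aζ * ℓ := htower ▸ hsup
      exact Nat.le_of_mul_le_mul_left this ha0
    have h5 : 0 < Module.finrank S Bζ := by
      rcases Nat.eq_zero_or_pos (Module.finrank S Bζ) with h | h
      · rw [h, mul_zero] at htower; omega
      · exact h
    obtain ⟨k, hk⟩ := h3
    rcases k with _ | k
    · omega
    · nlinarith
  -- the rebased extension `L | K` is cyclic of degree `ℓ` with `μ_ℓ ⊆ K`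
  have hKA' : (lift S).toSubfield = Subfield.closure ((A : Set E) ∪ {ζ}) := by rw [hS, hAζsub]
  have hfinKL : Module.finrank (lift S).toSubfield (Subfield.extendScalars (lift_toSubfield_le S)) = ℓ := by
    rw [finrank_extendScalars_lift S, hr]
  haveI : IsCyclic (Subfield.extendScalars (lift_toSubfield_le S) ≃ₐ[(lift S).toSubfield]
      Subfield.extendScalars (lift_toSubfield_le S)) := by
    apply isCyclic_of_prime_card (p := ℓ)
    rw [IsGalois.card_aut_eq_finrank, hfinKL]
  have hζK : ζ ∈ (lift S).toSubfield := by
    rw [hKA']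
    exact Subfield.subset_closure (Or.inr rfl)
  have hprim : (primitiveRoots (Module.finrank (lift S).toSubfield
      (Subfield.extendScalars (lift_toSubfield_le S))) (lift S).toSubfield).Nonempty := by
    rw [hfinKL]
    refine ⟨⟨ζ, hζK⟩, (mem_primitiveRoots hℓ.pos).mpr ?_⟩
    exact IsPrimitiveRoot.of_map_of_injective (f := algebraMap (lift S).toSubfield E) (by exact hζ)
      (algebraMap (lift S).toSubfield E).injective
  obtain ⟨α, hαℓ, hKα⟩ := exists_root_adjoin_eq_top_of_isCyclic (lift S).toSubfield
    (Subfield.extendScalars (lift_toSubfield_le S)) hprim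
  -- read off `θ`
  let θ : E := (α : E)
  have hLsub : (Subfield.extendScalars (lift_toSubfield_le S)).toSubfield = Bζ.toSubfield := rfl
  have hadj : adjoin (lift S).toSubfield ({θ} : Set E) = Subfield.extendScalars (lift_toSubfield_le S) := by
    have h1 := IntermediateField.lift_adjoin_simple _ (Subfield.extendScalars (lift_toSubfield_le S)) α
    rw [hKα, IntermediateField.lift_top] at h1
    exact h1.symm
  have hLcl : (Subfield.extendScalars (lift_toSubfield_le S)).toSubfield =
      Subfield.closure (((lift S).toSubfield : Set E) ∪ {θ}) := by
    rw [← hadj]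
    change Subfield.closure (Set.range (algebraMap (lift S).toSubfield E) ∪ {θ}) = _
    rw [show Set.range (algebraMap (lift S).toSubfield E) = ((lift S).toSubfield : Set E) from
      Subtype.range_coe]
  refine ⟨θ, ?_, ?_, ?_, ?_⟩
  · -- `θ ≠ 0` as `K⟮θ⟯ = L ≠ K`
    intro h0
    have h1 : α = 0 := Subtype.ext h0
    rw [h1, IntermediateField.adjoin_zero] at hKα
    have h2 : Module.finrank (lift S).toSubfield (Subfield.extendScalars (lift_toSubfield_le S)) = 1 := by
      rw [← IntermediateField.finrank_top', ← hKα, IntermediateField.finrank_bot]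
    rw [hfinKL] at h2
    exact hℓ.one_lt.ne' h2
  · -- `θ^ℓ ∈ A′ = K`
    rw [← hKA']
    obtain ⟨k, hk⟩ := hαℓ
    rw [hfinKL] at hk
    have h1 : θ ^ ℓ = ((k : (lift S).toSubfield) : E) := by
      have := congrArg (fun y : Subfield.extendScalars (lift_toSubfield_le S) => (y : E)) hk
      simp only [SubmonoidClass.coe_pow] at this
      exact this.symm
    rw [h1]
    exact k.2
  · -- `B ⊆ Bζ = L = closure (K ∪ {θ})`
    rw [← hKA', ← hLcl, hLsub]
    exact fun x hx => (le_sup_right : BA ≤ Bζ) (show x ∈ BA from hx)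
  · -- `θ ∈ Bζ ⊆ closure (B ∪ {ζ})`
    have hθ : θ ∈ Bζ.toSubfield := by rw [← hLsub]; exact α.2
    have hle : Bζ ≤ (Subfield.closure ((B : Set E) ∪ {ζ})).toIntermediateField
        (fun a => Subfield.subset_closure (Or.inl (hAB a.2))) := by
      refine sup_le ?_ ?_
      · change adjoin A _ ≤ _
        rw [IntermediateField.adjoin_le_iff]
        intro x hx
        change x ∈ Subfield.closure ((B : Set E) ∪ {ζ})
        have := (toSubfield_adjoin_rootSet_X_pow_sub_one hℓ0 hζ A).le
          (IntermediateField.subset_adjoin A _ hx)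
        exact Subfield.closure_mono (Set.union_subset_union_left _ hAB) this
      · intro x hx
        exact Subfield.subset_closure (Or.inl hx)
    exact hle hθ

end Kummer

/-! ## Tame ascent from tame descent -/

section Assembly

variable {S E : Type u} [CommRing S] [IsRegularLocalRing S] [Field E] [Algebra S E]

set_option maxHeartbeats 1600000 in
/-- **Input (C3) from input (C4): tame ascent along a Galois step of prime degree `ℓ ≠ p`
reduced to tame descent** (the replacement for [CoP1] Prop. 6.3 = HAL Prop. 8.3 (2) described
in `ArithmeticalThreefoldsLocalKummerCovering.lean`). Frame: `S` excellent regular local of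
dimension three and residue characteristic `p` in an algebraically closed valued field
`(E, O_E)` dominating it with residue field algebraic over that of `S`; `(LU X)` for a subfield
`X ∋ S` means a model `S[t] ⊆ O_E`, `t ⊆ X ⊆ Frac(S)(t)`, regular at the centre. Hypotheses:
embedded resolution of surfaces (`hEmb`, Cossart–Jannsen–Saito Cor. 1.5), cofinality of local
uniformizations at every subfield (`hCOF`, [CoP1] Cor. 4.6 ⇐ principalization), tame descent
at every subfield (`hC4`, [CoP1] Prop. 9.3/9.5: `(LU K′) ⇒ (LU M)` for `M ≤ K′ ≤ Kʳ`). Claim: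
for a Galois step `A ≤ B` of prime degree `ℓ ≠ p` (its position between the inertia and the
ramification field of an ambient Galois extension is part of the shape of (C3) but is not
used), `(LU A) ⇒ (LU B)`. Proof: `ζ_ℓ ∈ E` as `v(ℓ) = 0`; `A′ = A(ζ)` is unramified over `A`
(`inertiaGroupIn_eq_bot_adjoin_rootsOfUnity`), so `(LU A′)` by the étale climb; `B′ = B(ζ) =
A′(θ)` with `θ^ℓ = a ∈ A′` (`exists_kummer_generator`); if `v(θ) = 0`, `θ` is a Hensel root and
`(LU B′)` by the étale climb; otherwise (after `θ ↦ θ⁻¹`) `v(a) > 0`, the Kummer covering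
`A′(ρ) ∋ θ` of a model monomializing `a` is regular (`exists_model_adjoin_roots_of_monomial`)
and `B′(ρ) | B′` is Galois of exponent `ℓ`, hence with trivial ramification group, so `(LU B′)`
by descent; finally `B(ζ) | B` is unramified, so `(LU B)` by descent again.
[cite: CossartPiltant2019, proof of Prop. 4.10 (arXiv v1: Prop. 4.8, p. 54) "(LU v₀ⁱ) ⇒ (LU v₀ʳ)"]
[cite: CossartPiltant2008, Prop. 6.3, Lemma 9.4, Prop. 9.3 (HAL Prop. 8.3, Lemma 9.4, Prop. 9.5)] -/
theorem tameAscent_of_descent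
    (hEmb : ∀ (Z : Scheme.{u}) [IsIntegral Z] [IsNoetherian Z], Scheme.IsRegular Z →
      Scheme.IsExcellent Z → ∀ (X : Set Z), IsClosed X → X ≠ Set.univ → topologicalKrullDim X ≤ 2 →
        ∃ (Z' : Scheme.{u}) (π : Z' ⟶ Z), IsProper π ∧ Function.Surjective π.base ∧
          (∃ U : Z.Opens, (U : Set Z) = Xᶜ ∧ IsIso (π ∣_ U)) ∧
          IsStrictNormalCrossingsDivisor Z' (π.base ⁻¹' X))
    (p : ℕ) (hp : p.Prime) (hS : IsExcellentRing S) (hSdim : ringKrullDim S = 3)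
    (hSchar : CharP (ResidueField S) p)
    (hinj : Function.Injective (algebraMap S E)) [IsAlgClosed E] [Algebra.IsAlgebraic S E]
    (OE : ValuationSubring E) (hSO : ∀ s : S, algebraMap S E s ∈ OE)
    (hdom : ∀ s ∈ maximalIdeal S, OE.valuation (algebraMap S E s) < 1)
    (hres : ∀ y : OE, ∃ q : S[X], (∃ i, q.coeff i ∉ maximalIdeal S) ∧
      OE.valuation (q.eval₂ (algebraMap S E) y) < 1)
    (hCOF : ∀ (M : Subfield E), (∀ s : S, algebraMap S E s ∈ M) →
      ∀ (t : Finset E), (t : Set E) ⊆ M →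
        M ≤ Subfield.closure (Set.range (algebraMap S E) ∪ (t : Set E)) →
      ∀ (hTO : (Algebra.adjoin S (t : Set E)).toSubring ≤ OE.toSubring),
        IsRegularLocalRing (Localization.AtPrime
          (Ideal.comap (Subring.inclusion hTO) (maximalIdeal OE))) →
      ∀ (c : Finset E), (c : Set E) ⊆ M → (∀ x ∈ c, x ∈ OE) →
      ∃ t' : Finset E, (t' : Set E) ⊆ M ∧
        M ≤ Subfield.closure (Set.range (algebraMap S E) ∪ (t' : Set E)) ∧
        ∃ hTO' : (Algebra.adjoin S (t' : Set E)).toSubring ≤ OE.toSubring,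
          IsRegularLocalRing (Localization.AtPrime
            (Ideal.comap (Subring.inclusion hTO') (maximalIdeal OE))) ∧
          ∀ x ∈ c, ∃ a s : E, a ∈ Algebra.adjoin S (t' : Set E) ∧
            s ∈ Algebra.adjoin S (t' : Set E) ∧ OE.valuation s = 1 ∧ x * s = a)
    (hC4 : ∀ (M : Subfield E), (∀ s : S, algebraMap S E s ∈ M) →
      ∀ (N : IntermediateField M E) [FiniteDimensional M N] [IsGalois M N] (K' : Subfield E),
        M ≤ K' → K' ≤ (lift (fixedField (ramificationGroupIn OE N))).toSubfield →
        (∃ t : Finset E, (t : Set E) ⊆ K' ∧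
          K' ≤ Subfield.closure (Set.range (algebraMap S E) ∪ (t : Set E)) ∧
          ∃ hTO : (Algebra.adjoin S (t : Set E)).toSubring ≤ OE.toSubring,
            IsRegularLocalRing (Localization.AtPrime
              (Ideal.comap (Subring.inclusion hTO) (maximalIdeal OE)))) →
        (∃ t : Finset E, (t : Set E) ⊆ M ∧
          M ≤ Subfield.closure (Set.range (algebraMap S E) ∪ (t : Set E)) ∧
          ∃ hTO : (Algebra.adjoin S (t : Set E)).toSubring ≤ OE.toSubring,
            IsRegularLocalRing (Localization.AtPrime
              (Ideal.comap (Subring.inclusion hTO) (maximalIdeal OE)))))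
    (A B : Subfield E) (hSA : ∀ s : S, algebraMap S E s ∈ A) (hstep : IsPrimeGaloisStep p A B)
    (hLUA : ∃ t : Finset E, (t : Set E) ⊆ A ∧
      A ≤ Subfield.closure (Set.range (algebraMap S E) ∪ (t : Set E)) ∧
      ∃ hTO : (Algebra.adjoin S (t : Set E)).toSubring ≤ OE.toSubring,
        IsRegularLocalRing (Localization.AtPrime
          (Ideal.comap (Subring.inclusion hTO) (maximalIdeal OE)))) :
    ∃ t : Finset E, (t : Set E) ⊆ B ∧
      B ≤ Subfield.closure (Set.range (algebraMap S E) ∪ (t : Set E)) ∧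
      ∃ hTO : (Algebra.adjoin S (t : Set E)).toSubring ≤ OE.toSubring,
        IsRegularLocalRing (Localization.AtPrime
          (Ideal.comap (Subring.inclusion hTO) (maximalIdeal OE))) := by
  classical
  obtain ⟨hAB, ℓ, hℓ, hℓp, hfin, hgal⟩ := hstep
  haveI : Fact p.Prime := ⟨hp⟩
  haveI : Fact ℓ.Prime := ⟨hℓ⟩
  have hℓ0 : ℓ ≠ 0 := hℓ.ne_zero
  haveI : NeZero ℓ := ⟨hℓ0⟩
  have hSB : ∀ s : S, algebraMap S E s ∈ B := fun s => hAB (hSA s)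
  -- residue characteristic and `v(ℓ) = 1`
  haveI hchar : CharP (ResidueField OE) p :=
    charP_residueField_valuationSubring_of_dominates OE p hSchar hSO hdom
  have hvℓ : OE.valuation (ℓ : E) = 1 := by
    have hres0 : (ℓ : ResidueField OE) ≠ 0 := by
      intro h0
      have h1 : p ∣ ℓ := (CharP.cast_eq_zero_iff (ResidueField OE) p ℓ).mp h0
      exact hℓp ((Nat.prime_dvd_prime_iff_eq hp hℓ).mp h1).symm
    have hnotmem : (ℓ : OE) ∉ maximalIdeal OE := fun hmem => hres0 (by
      rw [← map_natCast (IsLocalRing.residue OE) ℓ, IsLocalRing.residue_eq_zero_iff]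
      exact hmem)
    have h1 : OE.valuation ((ℓ : OE) : E) = 1 := by
      have hle : OE.valuation ((ℓ : OE) : E) ≤ 1 := (OE.valuation_le_one_iff _).mpr (ℓ : OE).2
      have hnlt : ¬ OE.valuation ((ℓ : OE) : E) < 1 := fun hlt =>
        hnotmem ((ValuationSubring.valuation_lt_one_iff OE _).mpr hlt)
      exact le_antisymm hle (not_lt.mp hnlt)
    rwa [show ((ℓ : OE) : E) = (ℓ : E) from map_natCast OE.subtype ℓ] at h1
  have hℓE : (ℓ : E) ≠ 0 := fun h0 => by rw [h0, map_zero] at hvℓ; exact zero_ne_one hvℓ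
  -- a primitive `ℓ`-th root of unity
  obtain ⟨ζ, hζ⟩ : ∃ ζ : E, IsPrimitiveRoot ζ ℓ := by
    haveI : NeZero (ℓ : E) := ⟨hℓE⟩
    have hdeg : (cyclotomic ℓ E).degree ≠ 0 := by
      rw [degree_cyclotomic, Nat.totient_prime hℓ]
      exact_mod_cast Nat.sub_ne_zero_of_lt hℓ.one_lt
    obtain ⟨ζ, hζ⟩ := IsAlgClosed.exists_root (cyclotomic ℓ E) hdeg
    exact ⟨ζ, (isRoot_cyclotomic_iff).mp hζ⟩
  have hvζ : OE.valuation ζ = 1 := by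
    have h1 : OE.valuation ζ ^ ℓ = 1 := by rw [← map_pow, hζ.pow_eq_one, map_one]
    rcases pow_eq_one_iff.mp h1 with h | h
    · exact h
    · exact absurd h hℓ0
  have hζO : ζ ∈ OE := (OE.valuation_le_one_iff _).mp hvζ.le
  /- Step 1: `(LU A′)`, `A′ = A(ζ)` unramified over `A` -/
  let A' : Subfield E := Subfield.closure ((A : Set E) ∪ {ζ})
  have hAA' : A ≤ A' := fun x hx => Subfield.subset_closure (Or.inl hx)
  have hζA' : ζ ∈ A' := Subfield.subset_closure (Or.inr rfl)
  have hSA' : ∀ s : S, algebraMap S E s ∈ A' := fun s => hAA' (hSA s)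
  let NA : IntermediateField A E := adjoin A ((X ^ ℓ - C (1 : A) : Polynomial A).rootSet E)
  obtain ⟨hsepA, hsplA⟩ := separable_and_splits_X_pow_sub_C (M := A) hℓE (one_ne_zero)
  obtain ⟨hGalNA, hfinNA⟩ := isGalois_and_finiteDimensional_adjoin_rootSet (M := A) hsepA hsplA
  haveI := hGalNA
  haveI := hfinNA
  have hNAsub : NA.toSubfield = A' := toSubfield_adjoin_rootSet_X_pow_sub_one hℓ0 hζ A
  have hinNA : inertiaGroupIn OE NA = ⊥ := inertiaGroupIn_eq_bot_adjoin_rootsOfUnity OE hℓ0 hvℓ hζ NA rfl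
  have hLUA' : ∃ t : Finset E, (t : Set E) ⊆ A' ∧
      A' ≤ Subfield.closure (Set.range (algebraMap S E) ∪ (t : Set E)) ∧
      ∃ hTO : (Algebra.adjoin S (t : Set E)).toSubring ≤ OE.toSubring,
        IsRegularLocalRing (Localization.AtPrime
          (Ideal.comap (Subring.inclusion hTO) (maximalIdeal OE))) := by
    have h1 := exists_model_inertiaField_of_cofinal OE A NA (fun M' hM' => hCOF M' (by
      rcases hM' with rfl | rfl
      · exact hSA
      · intro s
        exact (lift (fixedField (decompositionGroupIn OE NA))).algebraMap_mem
          (⟨algebraMap S E s, hSA s⟩ : A))) hLUA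
    rw [(lift_fixedField_eq_of_inertiaGroupIn_eq_bot OE NA hinNA).1, hNAsub] at h1
    exact h1
  /- Step 2: the Kummer generator, normalized to `v(θ) ≤ 1` -/
  obtain ⟨θ₀, hθ₀0, hθ₀ℓ, hBcl₀, hθ₀B⟩ := exists_kummer_generator A B hAB hℓ hℓE hfin hgal hζ
  let Bc : Subfield E := Subfield.closure ((B : Set E) ∪ {ζ})
  have hBBc : B ≤ Bc := fun x hx => Subfield.subset_closure (Or.inl hx)
  have hA'Bc : A' ≤ Bc := Subfield.closure_mono (Set.union_subset_union_left _ hAB)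
  obtain ⟨θ, hθ0, hθℓ, hBcl, hθB, hvθ⟩ : ∃ θ : E, θ ≠ 0 ∧ θ ^ ℓ ∈ A' ∧
      B ≤ Subfield.closure ((A' : Set E) ∪ {θ}) ∧ θ ∈ Bc ∧ OE.valuation θ ≤ 1 := by
    by_cases hv : OE.valuation θ₀ ≤ 1
    · exact ⟨θ₀, hθ₀0, hθ₀ℓ, hBcl₀, hθ₀B, hv⟩
    · refine ⟨θ₀⁻¹, inv_ne_zero hθ₀0, ?_, ?_, Bc.inv_mem hθ₀B, ?_⟩
      · rw [inv_pow]; exact A'.inv_mem hθ₀ℓ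
      · refine hBcl₀.trans (Subfield.closure_le.mpr ?_)
        rintro x (hx | hx)
        · exact Subfield.subset_closure (Or.inl hx)
        · rw [Set.mem_singleton_iff.mp hx]
          have : θ₀⁻¹ ∈ Subfield.closure ((A' : Set E) ∪ {θ₀⁻¹}) :=
            Subfield.subset_closure (Or.inr rfl)
          have h2 := Subfield.inv_mem _ this
          rwa [inv_inv] at h2
      · rw [map_inv₀]
        exact (inv_lt_one₀ (lt_of_lt_of_le zero_lt_one (not_le.mp hv).le)).mpr (not_le.mp hv) |>.le
  let B' : Subfield E := Subfield.closure ((A' : Set E) ∪ {θ})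
  have hA'B' : A' ≤ B' := fun x hx => Subfield.subset_closure (Or.inl hx)
  have hθB' : θ ∈ B' := Subfield.subset_closure (Or.inr rfl)
  have hBB' : B ≤ B' := hBcl
  have hB'Bc : B' ≤ Bc := Subfield.closure_le.mpr (by
    rintro x (hx | hx)
    · exact hA'Bc hx
    · rw [Set.mem_singleton_iff.mp hx]; exact hθB)
  have hSB' : ∀ s : S, algebraMap S E s ∈ B' := fun s => hA'B' (hSA' s)
  have hζB' : ζ ∈ B' := hA'B' hζA'
  -- `B′ = A′⟮θ⟯` as the subfield of an intermediate field over `A′`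
  have hB'adj : (adjoin A' ({θ} : Set E)).toSubfield = B' := by
    change Subfield.closure (Set.range (algebraMap A' E) ∪ {θ}) = _
    rw [show Set.range (algebraMap A' E) = (A' : Set E) from Subtype.range_coe]
  /- Step 3: `(LU B′)` -/
  have hLUB' : ∃ t : Finset E, (t : Set E) ⊆ B' ∧
      B' ≤ Subfield.closure (Set.range (algebraMap S E) ∪ (t : Set E)) ∧
      ∃ hTO : (Algebra.adjoin S (t : Set E)).toSubring ≤ OE.toSubring,
        IsRegularLocalRing (Localization.AtPrime
          (Ideal.comap (Subring.inclusion hTO) (maximalIdeal OE))) := by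
    have hθO : θ ∈ OE := (OE.valuation_le_one_iff _).mp hvθ
    have hxA' : θ ^ ℓ ∈ A' := hθℓ
    have hxO : θ ^ ℓ ∈ OE := pow_mem hθO ℓ
    rcases hvθ.lt_or_eq with hvlt | hveq
    · /- `v(θ) > 0`: monomialize `x = θ^ℓ`, take the Kummer covering, descend -/
      set x : E := θ ^ ℓ with hxdef
      have hx0 : x ≠ 0 := pow_ne_zero _ hθ0
      have hxv : OE.valuation x < 1 := by
        rw [hxdef, map_pow]
        exact pow_lt_one₀ (zero_le (a := OE.valuation θ)) hvlt hℓ0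
      obtain ⟨t₀, ht₀A', hA'cl₀, hTO₀, hreg₀⟩ := hLUA'
      obtain ⟨t₁, ht₁A', hA'cl₁, hTO₁, hreg₁, hrep⟩ := hCOF A' hSA' t₀ ht₀A' hA'cl₀ hTO₀ hreg₀ {x}
        (by rw [Finset.coe_singleton, Set.singleton_subset_iff]; exact hxA')
        (fun y hy => by rw [Finset.mem_singleton.mp hy]; exact hxO)
      obtain ⟨a₀, s₀, ha₀, hs₀, hvs₀, hxs⟩ := hrep x (Finset.mem_singleton_self x)
      obtain ⟨n, ρ, e, hρA', hρ0, hxρ, t', ht'sub, hcl', hTO', hreg'⟩ :=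
        exists_model_adjoin_roots_of_monomial hEmb hS hSdim hinj OE hSO hdom hres A' hSA' t₁ ht₁A'
          hA'cl₁ hTO₁ hreg₁ x hx0 hxv a₀ s₀ ha₀ hs₀ hvs₀ hxs (Nat.pos_of_ne_zero hℓ0) hvℓ
      -- `θ ∈ M″ = A′(ρ)`
      have hθM : θ ∈ (adjoin A' (Set.range ρ)).toSubfield := by
        let P : E := ∏ j, ρ j ^ e j
        have hP0 : P ≠ 0 := Finset.prod_ne_zero_iff.mpr fun j _ => pow_ne_zero _ (hρ0 j)
        have hPℓ : P ^ ℓ = x := by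
          rw [hxρ, ← Finset.prod_pow]
          exact Finset.prod_congr rfl fun j _ => by rw [← pow_mul, mul_comm]
        have h1 : (θ / P) ^ ℓ = 1 := by rw [div_pow, hPℓ, hxdef, div_self hx0]
        obtain ⟨i, -, hi⟩ := hζ.eq_pow_of_pow_eq_one h1
        have hθeq : θ = ζ ^ i * P := by rw [hi, div_mul_cancel₀ _ hP0]
        rw [IntermediateField.mem_toSubfield, hθeq]
        refine mul_mem (pow_mem ((adjoin A' (Set.range ρ)).algebraMap_mem (⟨ζ, hζA'⟩ : A')) i) ?_
        exact prod_mem fun j _ => pow_mem (subset_adjoin A' (Set.range ρ) (Set.mem_range_self j)) _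
      have hB'M : B' ≤ (adjoin A' (Set.range ρ)).toSubfield := Subfield.closure_le.mpr (by
        rintro y (hy | hy)
        · exact (adjoin A' (Set.range ρ)).algebraMap_mem ⟨y, hy⟩
        · rw [Set.mem_singleton_iff.mp hy]; exact hθM)
      -- the Kummer covering `N″ = B′(ρ)` is Galois of exponent `ℓ`
      let c : Fin n → B' := fun j => ⟨ρ j ^ ℓ, hA'B' (hρA' j)⟩
      have hc0 : ∀ j, c j ≠ 0 := fun j h0 => pow_ne_zero ℓ (hρ0 j) (congrArg Subtype.val h0)
      have hcρ : ∀ j, ρ j ^ ℓ = ((c j : B') : E) := fun j => rfl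
      let N'' : IntermediateField B' E :=
        ⨆ j, adjoin B' ((X ^ ℓ - C (c j) : Polynomial B').rootSet E)
      obtain ⟨hGalN, hfinN⟩ := isGalois_iSup_adjoin_rootSet_X_pow_sub_C (M := B') hℓE c hc0
      haveI : IsGalois B' N'' := hGalN
      haveI : FiniteDimensional B' N'' := hfinN
      have hNeq : N'' = adjoin B' (⋃ j, ((X ^ ℓ - C (c j) : Polynomial B').rootSet E)) :=
        (IntermediateField.adjoin_iUnion _ _).symm
      have hexp : ∀ σ : N'' ≃ₐ[B'] N'', σ ^ ℓ = 1 :=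
        pow_eq_one_of_mem_aut_radical hℓ0 hζ hζB' c hc0 ρ hcρ N'' hNeq
      have hpl : ¬ p ∣ ℓ := fun h => hℓp ((Nat.prime_dvd_prime_iff_eq hp hℓ).mp h).symm
      have hramN : ramificationGroupIn OE N'' = ⊥ :=
        ramificationGroupIn_eq_bot_of_pow_eq_one OE N'' hpl hexp
      have hMN : (adjoin A' (Set.range ρ)).toSubfield ≤
          (lift (fixedField (ramificationGroupIn OE N''))).toSubfield := by
        rw [lift_fixedField_ramificationGroupIn_eq_of_eq_bot OE N'' hramN]
        change Subfield.closure (Set.range (algebraMap A' E) ∪ Set.range ρ) ≤ N''.toSubfield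
        rw [Subfield.closure_le]
        rintro y (⟨a, rfl⟩ | ⟨j, rfl⟩)
        · exact N''.algebraMap_mem ⟨(a : E), hA'B' a.2⟩
        · have hj : ρ j ∈ adjoin B' ((X ^ ℓ - C (c j) : Polynomial B').rootSet E) := by
            refine subset_adjoin _ _ ((mem_rootSet_X_pow_sub_C_iff hℓ0 hζ (hcρ j) (hρ0 j) _).mpr ?_)
            exact ⟨0, Nat.pos_of_ne_zero hℓ0, by rw [pow_zero, one_mul]⟩
          exact (le_iSup (fun j => adjoin B' ((X ^ ℓ - C (c j) : Polynomial B').rootSet E)) j) hj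
      exact hC4 B' hSB' N'' _ hB'M hMN ⟨t', ht'sub, hcl', hTO', hreg'⟩
    · /- `v(θ) = 0`: `θ` is a Hensel root of `X^ℓ − θ^ℓ` over `A′` -/
      let F : Polynomial E := X ^ ℓ - C (θ ^ ℓ)
      have hFmon : F.Monic := monic_X_pow_sub_C _ hℓ0
      have hFθ : F.eval θ = 0 := by simp only [F, eval_sub, eval_pow, eval_X, eval_C, sub_self]
      have hF' : OE.valuation ((derivative F).eval θ) = 1 := by
        have h1 : (derivative F).eval θ = (ℓ : E) * θ ^ (ℓ - 1) := by
          simp only [F, derivative_sub, derivative_X_pow, derivative_C, sub_zero, eval_mul,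
            eval_pow, eval_X, map_natCast, eval_natCast]
        rw [h1, map_mul, map_pow, hvℓ, hveq, one_pow, one_mul]
      have hFcoeff : ∀ k, F.coeff k ∈ OE ∧ F.coeff k ∈ A' := by
        intro k
        have hcoeff : F.coeff k = (if k = ℓ then 1 else 0) - (if k = 0 then θ ^ ℓ else 0) := by
          simp only [F, coeff_sub, coeff_X_pow, coeff_C]
        rw [hcoeff]
        constructor
        · refine sub_mem ?_ ?_
          · split_ifs
            · exact OE.one_mem
            · exact OE.zero_mem
          · split_ifs
            · exact hxO
            · exact OE.zero_mem
        · refine sub_mem ?_ ?_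
          · split_ifs
            · exact A'.one_mem
            · exact A'.zero_mem
          · split_ifs
            · exact hxA'
            · exact A'.zero_mem
      have h1 := exists_model_of_henselRoot_of_cofinal OE A' (hCOF A' hSA') hLUA' θ hθO F hFmon
        hFcoeff hFθ hF'
      rw [hB'adj] at h1
      exact h1
  /- Step 4: descent from `B′ ≤ B(ζ)` to `B`, `B(ζ) | B` being unramified -/
  let NB : IntermediateField B E := adjoin B ((X ^ ℓ - C (1 : B) : Polynomial B).rootSet E)
  obtain ⟨hsepB, hsplB⟩ := separable_and_splits_X_pow_sub_C (M := B) hℓE (one_ne_zero)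
  obtain ⟨hGalNB, hfinNB⟩ := isGalois_and_finiteDimensional_adjoin_rootSet (M := B) hsepB hsplB
  haveI := hGalNB
  haveI := hfinNB
  have hNBsub : NB.toSubfield = Bc := toSubfield_adjoin_rootSet_X_pow_sub_one hℓ0 hζ B
  have hinNB : inertiaGroupIn OE NB = ⊥ := inertiaGroupIn_eq_bot_adjoin_rootsOfUnity OE hℓ0 hvℓ hζ NB rfl
  have hramNB := (lift_fixedField_eq_of_inertiaGroupIn_eq_bot OE NB hinNB).2
  exact hC4 B hSB NB B' hBB' (by rw [hramNB, hNBsub]; exact hB'Bc) hLUB'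

end Assembly


/-! ## The reduction with (C3) discharged -/

/-- **Cossart–Piltant 2019, Prop. 4.10 from the local theorem, principalization, embedded
resolution of surfaces, tame descent and the rank-one reduction**:
`cossartPiltant2019ReductionP_of_principalization_of_parts` with its input (C3) (tame ascent)
discharged by `tameAscent_of_descent` — so that, besides the local theorem (the hypothesis of
`CossartPiltant2019ReductionP`) and principalization (`CossartPiltant2019Principalization`,
Prop. 4.4), the remaining inputs are embedded resolution of surfaces in regular excellent
schemes (`hEmb`, the statement of Cossart–Jannsen–Saito 2020 Cor. 1.5 = Cossart–Piltant 2019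
Prop. 4.3), (C4) descent below the ramification field ([CoP1] Prop. 9.3) and (C5) the reduction
to rank one ([NSp] Thm. 1.1; discharged from resolution of excellent surfaces in
`ArithmeticalThreefoldsLocalRankReduction.lean`).
[cite: CossartPiltant2019, Prop. 4.3, Prop. 4.4 and proof of Prop. 4.10 (arXiv v1: Props. 4.2, 4.3, 4.8, pp. 50–54)]
[cite: CossartPiltant2008, Prop. 6.3, Prop. 9.3 (HAL Prop. 8.3, Prop. 9.5)]
[cite: CossartJannsenSaito2020, Cor. 1.5, p. 7] -/
theorem cossartPiltant2019ReductionP_of_principalization_of_descent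
    (hloc : CossartPiltant2019Local.{u}) (h44 : CossartPiltant2019Principalization.{u})
    (hEmb : ∀ (Z : Scheme.{u}) [IsIntegral Z] [IsNoetherian Z], Scheme.IsRegular Z →
      Scheme.IsExcellent Z → ∀ (X : Set Z), IsClosed X → X ≠ Set.univ → topologicalKrullDim X ≤ 2 →
        ∃ (Z' : Scheme.{u}) (π : Z' ⟶ Z), IsProper π ∧ Function.Surjective π.base ∧
          (∃ U : Z.Opens, (U : Set Z) = Xᶜ ∧ IsIso (π ∣_ U)) ∧
          IsStrictNormalCrossingsDivisor Z' (π.base ⁻¹' X))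
    (hC4 :
      ∀ (p : ℕ), p.Prime →
      ∀ (S : Type u) [CommRing S] [IsDomain S] [IsRegularLocalRing S],
        IsExcellentRing S → ringKrullDim S = 3 → CharP (ResidueField S) p →
        IsAdicComplete (maximalIdeal S) S →
      ∀ (E : Type u) [Field E] [Algebra S E], Function.Injective (algebraMap S E) →
        IsAlgClosed E → Algebra.IsAlgebraic S E →
      ∀ (OE : ValuationSubring E), (∀ s : S, algebraMap S E s ∈ OE) →
        (∀ s ∈ maximalIdeal S, OE.valuation (algebraMap S E s) < 1) →
        (∀ y : OE, ∃ q : S[X], (∃ i, q.coeff i ∉ maximalIdeal S) ∧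
          OE.valuation (q.eval₂ (algebraMap S E) y) < 1) →
      Nonempty OE.valuation.RankOne →
      ∀ (M : Subfield E), (∀ s : S, algebraMap S E s ∈ M) →
      ∀ (N : IntermediateField M E) [FiniteDimensional M N] [IsGalois M N] (K' : Subfield E),
        M ≤ K' → K' ≤ (lift (fixedField (ramificationGroupIn OE N))).toSubfield →
        (∃ t : Finset E, (t : Set E) ⊆ K' ∧
          K' ≤ Subfield.closure (Set.range (algebraMap S E) ∪ (t : Set E)) ∧
          ∃ hTO : (Algebra.adjoin S (t : Set E)).toSubring ≤ OE.toSubring,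
            IsRegularLocalRing (Localization.AtPrime
              (Ideal.comap (Subring.inclusion hTO) (maximalIdeal OE)))) →
        (∃ t : Finset E, (t : Set E) ⊆ M ∧
          M ≤ Subfield.closure (Set.range (algebraMap S E) ∪ (t : Set E)) ∧
          ∃ hTO : (Algebra.adjoin S (t : Set E)).toSubring ≤ OE.toSubring,
            IsRegularLocalRing (Localization.AtPrime
              (Ideal.comap (Subring.inclusion hTO) (maximalIdeal OE)))))
    (hC5 :
      ∀ (p : ℕ), p.Prime →
      ∀ (S : Type u) [CommRing S] [IsDomain S] [IsRegularLocalRing S],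
        IsExcellentRing S → ringKrullDim S = 3 → CharP (ResidueField S) p →
        IsAdicComplete (maximalIdeal S) S →
      ∀ (E : Type u) [Field E] [Algebra S E], Function.Injective (algebraMap S E) →
        IsAlgClosed E → Algebra.IsAlgebraic S E →
      (∀ (OE : ValuationSubring E), Nonempty OE.valuation.RankOne →
        (∀ s : S, algebraMap S E s ∈ OE) →
        (∀ s ∈ maximalIdeal S, OE.valuation (algebraMap S E s) < 1) →
        (∀ y : OE, ∃ q : S[X], (∃ i, q.coeff i ∉ maximalIdeal S) ∧
          OE.valuation (q.eval₂ (algebraMap S E) y) < 1) →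
        ∀ s₀ : Finset E, ∃ t : Finset E,
            (t : Set E) ⊆ Subfield.closure (Set.range (algebraMap S E) ∪ (s₀ : Set E)) ∧
            (s₀ : Set E) ⊆ Subfield.closure (Set.range (algebraMap S E) ∪ (t : Set E)) ∧
            ∃ hTO : (Algebra.adjoin S (t : Set E)).toSubring ≤ OE.toSubring,
              IsRegularLocalRing (Localization.AtPrime
                (Ideal.comap (Subring.inclusion hTO) (maximalIdeal OE)))) →
      ∀ (OE : ValuationSubring E), (∀ s : S, algebraMap S E s ∈ OE) →
        (∀ s ∈ maximalIdeal S, OE.valuation (algebraMap S E s) < 1) →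
        (∀ y : OE, ∃ q : S[X], (∃ i, q.coeff i ∉ maximalIdeal S) ∧
          OE.valuation (q.eval₂ (algebraMap S E) y) < 1) →
        ∀ s₀ : Finset E, ∃ t : Finset E,
            (t : Set E) ⊆ Subfield.closure (Set.range (algebraMap S E) ∪ (s₀ : Set E)) ∧
            (s₀ : Set E) ⊆ Subfield.closure (Set.range (algebraMap S E) ∪ (t : Set E)) ∧
            ∃ hTO : (Algebra.adjoin S (t : Set E)).toSubring ≤ OE.toSubring,
              IsRegularLocalRing (Localization.AtPrime
                (Ideal.comap (Subring.inclusion hTO) (maximalIdeal OE)))) :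
    CossartPiltant2019ReductionP.{u} :=
  cossartPiltant2019ReductionP_of_principalization_of_parts hloc h44
    (fun p hp S _ _ _ hS hSdim hSchar hScomp E _ _ hinj hE halg OE hSO hdom hres hrk M hSM N _ _ A B
        hIA _hBR hstep hLUA => by
      haveI := hE
      haveI := halg
      have hSA : ∀ s : S, algebraMap S E s ∈ A := fun s =>
        hIA ((lift (fixedField (inertiaGroupIn OE N))).algebraMap_mem (⟨algebraMap S E s, hSM s⟩ : M))
      exact tameAscent_of_descent hEmb p hp hS hSdim hSchar hinj OE hSO hdom hres
        (cofinality_of_principalization h44 p hp S hS hSdim hSchar hScomp E hinj hE halg OE hSO hdom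
          hres)
        (hC4 p hp S hS hSdim hSchar hScomp E hinj hE halg OE hSO hdom hres hrk) A B hSA hstep hLUA)
    hC4 hC5

end Literature.AlgebraicGeometry.Resolution

end
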